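import Literature.MathematicalPhysics.QuantumFieldTheory.Balaban1983to89.B1TorusLabelWalk
import Literature.MathematicalPhysics.QuantumFieldTheory.Balaban1983to89.B1TorusRegionRop
import Literature.MathematicalPhysics.QuantumFieldTheory.Balaban1983to89.B1TorusCubeLpInput
import Literature.MathematicalPhysics.QuantumFieldTheory.Balaban1983to89.B4Ineq110LpChain

/-!
# `Balaban1983to89.B1Ineq225RegionChain` — [Balaban1982Higgs1] Prop. 2.1 (2.25) p. 610 (value member) = [Balaban1983RegularityDecay]
# Theorem (1.10)/(2.22) pp. 572, 579 FOR A BIG-BLOCK REGION `Ω ⊂ T_ε` UNDER `R₀` ON THE (Higgs)₂,₃ CARRIER, FROM THE LETTER ESTIMATES: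
# the printed walk expansion (2.12)–(2.22) — r01's abstract graded chain `B4Ineq110LpChain.lp_walk_bound_rem_exp` — instantiated in
# `Module.End ℝ (T_ε → ℝ^N)` with the projected letters of `B1TorusRegionRop`, the label torus of `B1TorusLabelWalk`, the sup norm at grade `0`
# and the `η`-weighted `L^{2n₀/i}` norms of `B1TorusCubeLpInput` at grades `1 ≤ i ≤ n₀`

statement-level skeleton of published theorems with citation tags; proofs where landed; nothing here is a claim about the Yang–Mills mass gap

PDF held: `paper:balaban1982-cmp85-higgs23-i` p. 610 [PDF 8]; `paper:balaban1983-cmp89-regularity-decay` pp. 572, 575–579 [PDF 2, 5–9] (text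
layer re-read by this seat).

CITATION HEADER (lean-in-tree rule).  T. Bałaban, *(Higgs)₂,₃ quantum fields in a finite volume. I. A lower bound*, Commun. Math. Phys. **85**
(1982) 603–626 [Balaban1982Higgs1] (Prop. 2.1 (2.25) p. 610) and T. Bałaban, *Regularity and decay of lattice Green's functions*, Commun. Math.
Phys. **89** (1983) 571–597 [Balaban1983RegularityDecay] (Theorem (1.10) p. 573 «for x ∈ Ω, dist(x, Ω^c) ≥ R₀», (2.12)–(2.13) p. 577, (2.18)–(2.22) pp. 578–579).
Docfix S-B1-g45-4 of ref-4 gen 45 (filed gen 13): the WHAT IS PRINTED block below now quotes only the printed sentences (text layer of the held PDFs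
and the ×2 renders `…-p008-x2.png`, `…-p009-x2.png` re-read); no declaration changed.  Cell `lit-balaban` (HOME `run/shared/lean/pub/lit-balaban/`), Phase-2 proof seat **p35** gen 12
(unit `lit-balaban-p35`); SKELETON rows **B1.Prop2.1** / **B1.Eq2.25** (regions of `T_ε` on the concrete carrier — the scope gap left by gens
10–11, which settled `Ω = T_ε`), **B4.Thm1.10(regions, carrier instance)**, **B4.Eq2.18**–**B4.Eq2.22**.  USED BY NAME, never restated: r01's
`B4Ineq110LpChain.lp_walk_bound_rem_exp` (the abstract (2.18)–(2.22) chain with remainder), `B4RandomWalk213.{IsWalk, lastPt}`; this seat's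
`B1TorusRegionCubes` (letters `aOp/bOp/Gloc`, `aOp_apply_norm_le`, `aOp_apply_eq_zero_off`, `aOp_apply_eq_zero_of_support`,
`bOp_apply_eq_zero_of_support`, `card_filter_near_rS_le`), `B1TorusRegionHSizes.{IsBigBlockUnion, blockSat_of_isBigBlockUnion}`,
`B1TorusRegionRop` (projected letters, `GP_eq`, locality, `exists_tail_le`), `B1TorusLabelWalk` (`LAdj`, `ladj_of_near_near`,
`card_filter_ladj_le`, `tdist_le_of_walk_near`, `cube_subset_of_walk`), `B1TorusCubeLpInput.lpT`, gen 10's `tdist_le_of_near`, the typer's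
`HiggsCovariance.propagatorK`, `HiggsCovarianceCont.sNorm`.

WHAT IS PRINTED.  [B1] p. 610: *«Similarly we have |(D^η_{A,μ}G_k(Ω, A)f)(x)|, |(G_k(Ω, A)f)(x)| ≤ c₀exp(−δ₀dist(x, supp f))‖f‖_∞ (2.25) for x ∈ Ω,
dist(x, Ω^c) ≥ R₀.»*  [B4] p. 578: *«The first is finite and the condition dist({x, x′}, Ω^c) ≥ R₀, together with the definition (2.19) of R₀
imply that all □_{ω_i} are cubes contained in Ω. The same of course holds for the first n₀ elements of the sequences ω in the second sum.»*;
p. 579: *«The summation in (2.18) is restricted to paths ω satisfying x, x′ ∈ □_{ω₀}, supp f ⊂ □_{ω_n}, so the length n satisfies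
n ≥ M⁻¹dist({x, x′}, supp f) − 2. There are at most 2^d(3^d)^{n−1}2^d of such paths, so finally we get the inequality (the left hand side of
(1.9)) ≤ Σ_n 2^dc₁(3^dc₂O(1)M⁻¹)ⁿ‖f‖_∞ ≤ (2^{d+1}/e²)e^{−M⁻¹dist({x,x′}, supp f)}‖f‖_∞, (2.22) where n ≥ M⁻¹dist({x, x′}, supp f) − 2, and if M is
fixed such that 3^dc₂O(1)M⁻¹ ≤ e⁻¹. Thus the inequality (1.9) is proved, similarly the inequalities (1.10).»*

WHAT THIS FILE PROVES (kernel-checked, zero `sorry`; one small definition with a body + theorems; no `Prop` fact).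
* §1 `nrmT K n₀` (the graded norm family: `‖·‖_∞` at grade `0`, `‖·‖_{2n₀/i,η}` at grade `i ≥ 1`), `lpT_mono_of_norm_le`, `lpT_neg`,
  `lpT_chi_smul_le`, **`lpT_two_eq`** (`‖ψ‖_{2,η} = (vol·ε^d)^{−1/2}·|ψ|` — the (1.5) norm and the `η`-weighted `L²` norm are proportional),
  `cube_subset_of_near` (the cubes seeing `x` are interior under `R₀`).
* §2 **`ineq225_value_region_of_inputs`** — FOR `Ω` A BIG-BLOCK UNION, `x` WITH `{|y − x| ≤ 2rS + 2M(n₀+1)} ⊂ Ω` (`R₀`), `f` vanishing within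
  `Dist` of `x`, and the LETTER ESTIMATES as hypotheses (sup letter `γ` of `G_j h_j` and the four `b_j`-letters `β` at interior cubes in the
  graded norms, the `L²` letter `β` at every piece for `Ω`-supported inputs, `3^dβ ≤ e^{−1}`, `‖f‖_{2,η} ≤ V‖f‖_∞`):
  `|(G^ε_K(Ω, A)1_Ωf)(x)| ≤ 2·2^d·γ·V·exp(−(Dist − 4rS)/(2M))·‖f‖_∞` — the value member of (2.25)/(1.10) for the region with
  `δ₀ = 1/(2K₀)` per `L^Kε` and `O(1) = 2·2^dγV`, `γ = C_γ(L^Kε)²`.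
HONEST SCOPE.  (i) The letter estimates are HYPOTHESES here (discharged from (2.23) in the sequel `B1Ineq225RegularRegion`: interior cubes by
`B1TorusCubeLpInput.cube_inputs_lp`, boundary pieces by `B1Lemma21RegularRegion.sNorm_bOp_le_of_bad`).  (ii) Value member only; the derivative
member, the Hölder estimate (2.24) and (2.26) are separate rows.  (iii) `R₀` in the site form `{|y − x| ≤ 2rS + 2M(n₀+1)} ⊂ Ω` (the print defines `R₀` by (2.19): «R₀ = (diameter of ⋃ … □_{ω_i}) + 2M»).
Unit `lit-balaban-p35` gen 12 (literature-prover-lit-balaban-p35-g12-0).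
-/

open scoped BigOperators

noncomputable section

namespace Literature.MathematicalPhysics.QuantumFieldTheory.Balaban1983to89.B1Ineq225RegionChain

open Literature.MathematicalPhysics.QuantumFieldTheory.Balaban1983to89.HiggsLattice
open Literature.MathematicalPhysics.QuantumFieldTheory.Balaban1983to89.HiggsCovariance
open Literature.MathematicalPhysics.QuantumFieldTheory.Balaban1983to89.HiggsCovariancePos
open Literature.MathematicalPhysics.QuantumFieldTheory.Balaban1983to89.HiggsCovarianceCont (sNorm sNorm_nonneg sNorm_sq)
open Literature.MathematicalPhysics.QuantumFieldTheory.Balaban1983to89.B1TorusCubeCover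
open Literature.MathematicalPhysics.QuantumFieldTheory.Balaban1983to89.B1TorusCubeLocality26 (rS rS_succ_lt_half)
open Literature.MathematicalPhysics.QuantumFieldTheory.Balaban1983to89.B1TorusCubeChart (dd)
open Literature.MathematicalPhysics.QuantumFieldTheory.Balaban1983to89.B4Lemma22EtaBox (vol vol_pos)
open Literature.MathematicalPhysics.QuantumFieldTheory.Balaban1983to89.B1TorusRegionCubes
open Literature.MathematicalPhysics.QuantumFieldTheory.Balaban1983to89.B1TorusRegionHSizes (IsBigBlockUnion blockSat_of_isBigBlockUnion)
open Literature.MathematicalPhysics.QuantumFieldTheory.Balaban1983to89.B1TorusRegionRop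
open Literature.MathematicalPhysics.QuantumFieldTheory.Balaban1983to89.B1TorusLabelWalk
open Literature.MathematicalPhysics.QuantumFieldTheory.Balaban1983to89.B1TorusCubeLpInput (lpT lpT_def lpT_nonneg)
open Literature.MathematicalPhysics.QuantumFieldTheory.Balaban1983to89.B1Ineq225DecayBackgroundTorus (tdist_le_of_near)
open Literature.MathematicalPhysics.QuantumFieldTheory.Balaban1983to89.B1Ineq234LevelZero (tdist_triangle_real)
open Literature.MathematicalPhysics.QuantumFieldTheory.Balaban1983to89.B4Lemma22LpStair (lpS lpS_nonneg lpS_mono')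
open Literature.MathematicalPhysics.QuantumFieldTheory.Balaban1983to89.B4RandomWalk213 (IsWalk lastPt)
open Literature.MathematicalPhysics.QuantumFieldTheory.Balaban1983to89.B4Ineq110LpChain (lp_walk_bound_rem_exp)

variable {P : HiggsLattice.Params} {N : ℕ}

/-! ## §1 The graded norm family and the `L²` dictionary -/

section Norms

variable (K : ℕ)

/-- **THE GRADED NORM FAMILY OF (2.18)/(2.21)** on `T_ε`: the sup norm at grade `0` and the `η`-weighted `L^{2n₀/i}` norm at grade
`1 ≤ i ≤ n₀` (so grade `n₀` is `L²` and consecutive grades differ by `1/(2n₀)` in `1/p`). [cite: Balaban1983RegularityDecay, (2.18), (2.21) p.578] -/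
def nrmT (n₀ : ℕ) (i : ℕ) (g : HiggsLattice.ScalarField P 0 N) : ℝ :=
  if i = 0 then ‖g‖ else lpT K (2 * n₀ / i : ℝ) g

variable {K}

/-- Grade `0` is the sup norm. [cite: Balaban1983RegularityDecay, (2.18) p.578] -/
theorem nrmT_zero (n₀ : ℕ) (g : HiggsLattice.ScalarField P 0 N) : nrmT K n₀ 0 g = ‖g‖ := if_pos rfl

/-- Grade `i ≥ 1` is `‖·‖_{2n₀/i,η}`. [cite: Balaban1983RegularityDecay, (2.21) p.578] -/
theorem nrmT_of_ne_zero (n₀ : ℕ) {i : ℕ} (hi : i ≠ 0) (g : HiggsLattice.ScalarField P 0 N) :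
    nrmT K n₀ i g = lpT K (2 * n₀ / i : ℝ) g := if_neg hi

/-- Grade `n₀` is `‖·‖_{2,η}`. [cite: Balaban1983RegularityDecay, (2.21) p.578] -/
theorem nrmT_top {n₀ : ℕ} (hn₀ : n₀ ≠ 0) (g : HiggsLattice.ScalarField P 0 N) : nrmT K n₀ n₀ g = lpT K 2 g := by
  rw [nrmT_of_ne_zero n₀ hn₀]
  congr 1
  have : (n₀ : ℝ) ≠ 0 := by exact_mod_cast hn₀
  field_simp

/-- `‖·‖_{p,η}` is monotone under pointwise domination. [cite: Balaban1983RegularityDecay, (2.17) p.578] -/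
theorem lpT_mono_of_norm_le {p : ℝ} (hp : 0 < p) {ψ φ : HiggsLattice.ScalarField P 0 N} (h : ∀ x, ‖ψ x‖ ≤ ‖φ x‖) :
    lpT K p ψ ≤ lpT K p φ := by
  rw [lpT_def, lpT_def]
  exact mul_le_mul_of_nonneg_left (lpS_mono' hp (fun x => norm_nonneg _) h)
    (Real.rpow_nonneg (inv_nonneg.2 (vol_pos _ _ _).le) _)

/-- `‖−ψ‖_{p,η} = ‖ψ‖_{p,η}`. [cite: Balaban1983RegularityDecay, (2.17) p.578] -/
theorem lpT_neg (p : ℝ) (ψ : HiggsLattice.ScalarField P 0 N) : lpT K p (-ψ) = lpT K p ψ := by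
  rw [lpT_def, lpT_def]
  congr 2
  funext x
  rw [Pi.neg_apply, norm_neg]

/-- `‖1_Ωg‖_{p,η} ≤ ‖g‖_{p,η}`. [cite: Balaban1983RegularityDecay, (2.17) p.578] -/
theorem lpT_chi_smul_le (Ω : Finset (HiggsLattice.Site P 0)) {p : ℝ} (hp : 0 < p) (g : HiggsLattice.ScalarField P 0 N) :
    lpT K p (chi Ω • g) ≤ lpT K p g :=
  lpT_mono_of_norm_le hp (norm_chi_smul_apply_le Ω g)

/-- The proportionality constant between `‖·‖_{2,η}` and the (1.5) norm: `(vol)^{−1/2}·ε^{−d/2} > 0`. [cite: Balaban1982Higgs1, (1.5) p.604] -/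
theorem cTwo_pos (P : HiggsLattice.Params) (K : ℕ) :
    0 < (vol (dd P) (P.L - 1) K)⁻¹ ^ (2 : ℝ)⁻¹ * (Real.sqrt (P.mesh 0 ^ P.d))⁻¹ :=
  mul_pos (Real.rpow_pos_of_pos (inv_pos.2 (vol_pos _ _ _)) _) (inv_pos.2 (Real.sqrt_pos.2 (pow_pos (P.mesh_pos 0) _)))

/-- **`‖ψ‖_{2,η} = (vol)^{−1/2}ε^{−d/2}·|ψ|`**: the `η`-weighted `L²` norm of the chain and the (1.5) norm of [B1] are proportional (so relative
`L²` letter bounds transfer verbatim). [cite: Balaban1982Higgs1, (1.5) p.604] [cite: Balaban1983RegularityDecay, (2.15) p.577] -/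
theorem lpT_two_eq (ψ : HiggsLattice.ScalarField P 0 N) :
    lpT K 2 ψ = (vol (dd P) (P.L - 1) K)⁻¹ ^ (2 : ℝ)⁻¹ * (Real.sqrt (P.mesh 0 ^ P.d))⁻¹ * sNorm ψ := by
  have hs : 0 < Real.sqrt (P.mesh 0 ^ P.d) := Real.sqrt_pos.2 (pow_pos (P.mesh_pos 0) _)
  have hS : lpS 2 (fun x : HiggsLattice.Site P 0 => ‖ψ x‖) = Real.sqrt (∑ x : HiggsLattice.Site P 0, ‖ψ x‖ ^ 2) := by
    unfold lpS
    rw [Real.sqrt_eq_rpow, show ((2 : ℝ)⁻¹) = 1 / 2 by norm_num]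
    congr 1
    refine Finset.sum_congr rfl fun x _ => ?_
    rw [abs_norm, show (2 : ℝ) = ((2 : ℕ) : ℝ) by norm_num, Real.rpow_natCast]
  have hN : sNorm ψ = Real.sqrt (P.mesh 0 ^ P.d) * Real.sqrt (∑ x : HiggsLattice.Site P 0, ‖ψ x‖ ^ 2) := by
    unfold sNorm
    rw [siteInner_self_eq, ← Finset.mul_sum, Real.sqrt_mul (pow_nonneg (P.mesh_pos 0).le _)]
  rw [lpT_def, hS, hN, mul_assoc, ← mul_assoc (Real.sqrt (P.mesh 0 ^ P.d))⁻¹, inv_mul_cancel₀ hs.ne', one_mul]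

/-- **THE CUBES SEEING `x` ARE INTERIOR UNDER `R₀`**: if every site within `2rS + 2M` of `x` lies in `Ω` and `|x − Mi| ≤ rS`, then `□_i ⊂ Ω`.
[cite: Balaban1983RegularityDecay, (2.19) p.578] -/
theorem cube_subset_of_near {K K₀ : ℕ} {Ω : Finset (HiggsLattice.Site P 0)} {x : HiggsLattice.Site P 0} {R : ℕ}
    (hR : ∀ y, HiggsLattice.Site.tdist x y ≤ R → y ∈ Ω) (hRle : 2 * rS P K K₀ + 2 * half P K K₀ ≤ R) {i : Lab P K K₀}
    (hx : Near K K₀ (rS P K K₀) i x) : cube K K₀ i ⊆ Ω := by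
  intro y hy
  apply hR
  have h1 : HiggsLattice.Site.tdist x (centerSite K K₀ i) ≤ 2 * rS P K K₀ := tdist_le_of_near hx (near_center _ i)
  have h2 : HiggsLattice.Site.tdist (centerSite K K₀ i) y ≤ 2 * half P K K₀ :=
    tdist_le_of_near (near_center _ i) (near_half_of_mem_cube hy)
  have t := tdist_triangle_real x (centerSite K K₀ i) y
  have h : (HiggsLattice.Site.tdist x y : ℝ) ≤ R := by
    have h1' : (HiggsLattice.Site.tdist x (centerSite K K₀ i) : ℝ) ≤ 2 * rS P K K₀ := by exact_mod_cast h1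
    have h2' : (HiggsLattice.Site.tdist (centerSite K K₀ i) y : ℝ) ≤ 2 * half P K K₀ := by exact_mod_cast h2
    have h3 : (2 * rS P K K₀ + 2 * half P K K₀ : ℝ) ≤ R := by exact_mod_cast hRle
    linarith
  exact_mod_cast h

end Norms

/-! ## §2 (2.25)/(1.10) value member for a big-block region under `R₀`, from the letter estimates -/

section Chain

variable (C : ChargeData N) {K K₀ : ℕ} (Ω : Finset (HiggsLattice.Site P 0)) (A : HiggsLattice.VecField P 0) {msq a : ℝ}

set_option maxHeartbeats 800000 in
/-- **(2.25)/(1.10) FOR A REGION, VALUE MEMBER, FROM THE LETTER ESTIMATES.**  `Ω ⊂ T_ε` a big-block union, `K ≤ K_P`, `K₀ ∣ M_P`, `K₀ ≥ 8`,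
`3M ≤ |T_ε|_μ`, `m² > 0`, `a_K ≥ 0`; `n₀ ≥ 1`; letter constants `γ, β ≥ 0` with `3^dβ ≤ e^{−1}` such that at every INTERIOR cube `□_j ⊂ Ω`:
`‖G_j(h_jψ)‖_∞ ≤ γ‖ψ‖_∞` ((2.17)), `‖b_jψ‖_∞ ≤ β‖ψ‖_∞` ((2.20)), `‖b_jψ‖_{q,η} ≤ β‖ψ‖_{p,η}` for `1 ≤ p ≤ q`, `1/p − 1/q ≤ 1/(2n₀)` and
`‖b_jψ‖_∞ ≤ β‖ψ‖_{2n₀,η}` ((2.21)), and at EVERY piece `|b_jψ| ≤ β|ψ|` for `Ω`-supported `ψ` (Lemma 2.1); `x` with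
`{y : |y − x| ≤ 2rS + 2M(n₀+1)} ⊂ Ω` (`R₀`); `f` vanishing at the sites within `Dist` of `x`, `‖f‖_{2,η} ≤ V‖f‖_∞`, `V ≥ 1`.  THEN
`|(G^ε_K(Ω, A)1_Ωf)(x)| ≤ 2·2^d·γ·V·exp(−(Dist − 4rS)/(2M))·‖f‖_∞`.
[cite: Balaban1982Higgs1, Prop. 2.1 (2.25) p.610] [cite: Balaban1983RegularityDecay, Theorem (1.10) p.572, (2.18)–(2.22) pp.578–579] -/
theorem ineq225_value_region_of_inputs (hK : K ≤ P.K) (hK₀ : K₀ ∣ P.M) (hK₀8 : 8 ≤ K₀)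
    (hN3 : ∀ μ, 3 * half P K K₀ ≤ P.sitesPerDir 0 μ) (hΩ : IsBigBlockUnion K K₀ Ω) (hmsq : 0 < msq) (hak : 0 ≤ B1.aSeq a P.L K)
    {n₀ : ℕ} (hn₀ : 1 ≤ n₀) {γ β : ℝ} (hγ : 0 ≤ γ) (hβ : 0 ≤ β) (hDβ : (3 : ℝ) ^ P.d * β ≤ Real.exp (-1))
    (hGsup : ∀ j : Lab P K K₀, cube K K₀ j ⊆ Ω → ∀ ψ : HiggsLattice.ScalarField P 0 N,
      ‖Gloc C K K₀ Ω A msq a j (hTor K K₀ j • ψ)‖ ≤ γ * ‖ψ‖)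
    (h0 : ∀ j : Lab P K K₀, cube K K₀ j ⊆ Ω → ∀ ψ : HiggsLattice.ScalarField P 0 N, ‖bOp C K K₀ Ω A msq a j ψ‖ ≤ β * ‖ψ‖)
    (hgr : ∀ j : Lab P K K₀, cube K K₀ j ⊆ Ω → ∀ p q : ℝ, 1 ≤ p → p ≤ q → p⁻¹ - q⁻¹ ≤ (2 * n₀ : ℝ)⁻¹ →
      ∀ ψ : HiggsLattice.ScalarField P 0 N, lpT K q (bOp C K K₀ Ω A msq a j ψ) ≤ β * lpT K p ψ)
    (hps : ∀ j : Lab P K K₀, cube K K₀ j ⊆ Ω → ∀ ψ : HiggsLattice.ScalarField P 0 N,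
      ‖bOp C K K₀ Ω A msq a j ψ‖ ≤ β * lpT K (2 * n₀) ψ)
    (h2 : ∀ (j : Lab P K K₀) (ψ : HiggsLattice.ScalarField P 0 N), (∀ y, y ∉ Ω → ψ y = 0) →
      sNorm (bOp C K K₀ Ω A msq a j ψ) ≤ β * sNorm ψ)
    (x : HiggsLattice.Site P 0) (hR : ∀ y, HiggsLattice.Site.tdist x y ≤ 2 * rS P K K₀ + 2 * half P K K₀ * (n₀ + 1) → y ∈ Ω)
    (f : HiggsLattice.ScalarField P 0 N) {Dist : ℕ} (hf : ∀ y, f y ≠ 0 → Dist ≤ HiggsLattice.Site.tdist x y)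
    {V : ℝ} (hV : 1 ≤ V) (hfV : lpT K 2 f ≤ V * ‖f‖) :
    ‖propagatorK C Ω A msq a K (chi Ω • f) x‖
      ≤ 2 * 2 ^ P.d * γ * V * Real.exp (-(((Dist : ℝ) - 4 * rS P K K₀) / (2 * half P K K₀))) * ‖f‖ := by
  classical
  have hK₀' : 1 ≤ K₀ := le_trans (by norm_num) hK₀8
  have hh : 0 < (half P K K₀ : ℝ) := by exact_mod_cast half_pos hK₀'
  have hΩb := blockSat_of_isBigBlockUnion (K₀ := K₀) hK hΩ
  have hn₀0 : n₀ ≠ 0 := by omega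
  have hn₀r : (0 : ℝ) < n₀ := by exact_mod_cast hn₀
  -- smallness of `β`
  have h23 : (2 : ℝ) ^ P.d * β < 1 := by
    have h1 : (2 : ℝ) ^ P.d ≤ 3 ^ P.d := pow_le_pow_left₀ (by norm_num) (by norm_num) _
    have h2 : Real.exp (-1) < 1 := Real.exp_lt_one_iff.2 (by norm_num)
    nlinarith [mul_le_mul_of_nonneg_right h1 hβ]
  -- the sets `S₀`, `S₁` and the separation count `N`
  set S₀ : Finset (Lab P K K₀) := Finset.univ.filter fun i => Near K K₀ (rS P K K₀) i x with hS₀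
  set S₁ : Finset (Lab P K K₀) := Finset.univ.filter fun l => ∃ y, f y ≠ 0 ∧ Near K K₀ (rS P K K₀) l y with hS₁
  set Nn : ℕ := ⌈((Dist : ℝ) - 4 * rS P K K₀) / (2 * half P K K₀)⌉₊ with hNn
  have hgoodS₀ : ∀ i ∈ S₀, cube K K₀ i ⊆ Ω := fun i hi => by
    rw [hS₀, Finset.mem_filter] at hi
    refine cube_subset_of_near hR ?_ hi.2
    nlinarith [Nat.zero_le (half P K K₀)]
  -- the abstract chain
  have hmain := lp_walk_bound_rem_exp (R := Module.End ℝ (HiggsLattice.ScalarField P 0 N)) (E := HiggsLattice.ScalarField P 0 N)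
    (LAdj K K₀) (a := aOpP C K K₀ Ω A msq a) (b := bOpP C K K₀ Ω A msq a)
    (G := GP C K Ω A msq a) (G₀ := G0P C K K₀ Ω A msq a) (Rop := RopP C K K₀ Ω A msq a) (f := f)
    (Φ := fun w : HiggsLattice.ScalarField P 0 N => ‖w x‖) (nrm := nrmT K n₀) (good := fun j : Lab P K K₀ => cube K K₀ j ⊆ Ω)
    (S₀ := S₀) (S₁ := S₁) (c₁ := γ) (β := β) (r := (Nn : ℝ) + 2) (D := 3 ^ P.d) (N := Nn) (n₀ := n₀) (V := V)
    G0P_eq_sum RopP_eq_sum (GP_eq C Ω A hK hK₀ hK₀8 hN3 hΩb hmsq hak)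
    (fun ε' hε' => exists_tail_le C Ω A hK hK₀ hK₀8 hmsq hak hβ h23 h2 f x ε' hε')
    (fun i l hil => aOpP_mul_bOpP_eq_zero C Ω A hK hK₀ hK₀8 hN3 hΩb hmsq hak i l fun y hy =>
      hil (ladj_of_near_near hK hK₀ hK₀8 hy.1 hy.2))
    (fun i l hil => bOpP_mul_bOpP_eq_zero C Ω A hK hK₀ hK₀8 hN3 hΩb hmsq hak i l fun y hy =>
      hil (ladj_of_near_near hK hK₀ hK₀8 hy.1 hy.2))
    (by simp) (fun u v => norm_add_le (u x) (v x))
    (fun i hi g => by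
      have hi' : ¬ Near K K₀ (rS P K K₀) i x := fun h => hi (by rw [hS₀, Finset.mem_filter]; exact ⟨Finset.mem_univ _, h⟩)
      show ‖(aOpP C K K₀ Ω A msq a i g) x‖ ≤ 0
      rw [aOpP_apply, aOp_apply_eq_zero_off C Ω A msq a hK hK₀ hK₀8 i _ hi', norm_zero])
    (fun i hi => by
      show aOpP C K K₀ Ω A msq a i f = 0
      rw [aOpP_apply]
      refine aOp_apply_eq_zero_of_support C Ω A msq a hK hK₀ hK₀8 i _ fun z hz hzn => hi ?_
      rw [hS₁, Finset.mem_filter]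
      refine ⟨Finset.mem_univ _, z, fun hf0 => hz ?_, hzn⟩
      rw [chi_smul_apply]; split_ifs <;> simp [hf0])
    (fun i hi => by
      show bOpP C K K₀ Ω A msq a i f = 0
      rw [bOpP_apply]
      refine bOp_apply_eq_zero_of_support C Ω A msq a hK hK₀ hK₀8 i _ fun z hz hzn => hi ?_
      rw [hS₁, Finset.mem_filter]
      refine ⟨Finset.mem_univ _, z, fun hf0 => hz ?_, hzn⟩
      rw [chi_smul_apply]; split_ifs <;> simp [hf0])
    hγ
    (fun i hi g => by
      show ‖(aOpP C K K₀ Ω A msq a i g) x‖ ≤ γ * nrmT K n₀ 0 g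
      rw [aOpP_apply, nrmT_zero]
      exact (aOp_apply_norm_le C Ω A msq a hK hK₀ hK₀8 i (hGsup i (hgoodS₀ i hi)) _ x).trans
        (mul_le_mul_of_nonneg_left (norm_chi_smul_le Ω g) hγ))
    hβ
    (fun j hj i hi1 hin g => by
      show nrmT K n₀ (i - 1) (bOpP C K K₀ Ω A msq a j g) ≤ β * nrmT K n₀ i g
      rw [bOpP_apply, nrmT_of_ne_zero n₀ (by omega : i ≠ 0)]
      rcases Nat.lt_or_ge 1 i with hi2 | hi2
      · -- grades `i − 1 ≥ 1`: the (p, q) letter with `1/p − 1/q = 1/(2n₀)`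
        rw [nrmT_of_ne_zero n₀ (by omega : i - 1 ≠ 0)]
        have hir : (1 : ℝ) < i := by exact_mod_cast hi2
        have hi0 : (0 : ℝ) < i := by linarith
        have him : (0 : ℝ) < (i : ℝ) - 1 := by linarith
        have hcast : (((i - 1 : ℕ)) : ℝ) = (i : ℝ) - 1 := by rw [Nat.cast_sub (by omega), Nat.cast_one]
        rw [hcast]
        have hp1 : (1 : ℝ) ≤ 2 * n₀ / i := by
          rw [le_div_iff₀ hi0, one_mul]
          have : (i : ℝ) ≤ n₀ := by exact_mod_cast hin
          linarith
        have hpq : (2 * n₀ / i : ℝ) ≤ 2 * n₀ / ((i : ℝ) - 1) :=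
          div_le_div_of_nonneg_left (by positivity) him (by linarith)
        have hdiff : (2 * n₀ / i : ℝ)⁻¹ - (2 * n₀ / ((i : ℝ) - 1))⁻¹ ≤ (2 * n₀ : ℝ)⁻¹ := by
          rw [inv_div, inv_div]
          have : (i : ℝ) / (2 * n₀) - ((i : ℝ) - 1) / (2 * n₀) = (2 * n₀ : ℝ)⁻¹ := by field_simp; ring
          rw [this]
        exact (hgr j hj _ _ hp1 hpq hdiff (chi Ω • g)).trans
          (mul_le_mul_of_nonneg_left (lpT_chi_smul_le Ω (by positivity) g) hβ)
      · -- grade `0` from grade `1`: the (p₁, ∞) letter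
        have hi1' : i = 1 := by omega
        subst hi1'
        rw [show (1 - 1 : ℕ) = 0 from rfl, nrmT_zero, Nat.cast_one, div_one]
        exact (hps j hj (chi Ω • g)).trans (mul_le_mul_of_nonneg_left (lpT_chi_smul_le Ω (by positivity) g) hβ))
    (fun j g => by
      show nrmT K n₀ n₀ (bOpP C K K₀ Ω A msq a j g) ≤ β * nrmT K n₀ n₀ g
      rw [bOpP_apply, nrmT_top hn₀0, nrmT_top hn₀0, lpT_two_eq, lpT_two_eq]
      have hc := cTwo_pos P K
      calc (vol (dd P) (P.L - 1) K)⁻¹ ^ (2 : ℝ)⁻¹ * (Real.sqrt (P.mesh 0 ^ P.d))⁻¹ * sNorm (bOp C K K₀ Ω A msq a j (chi Ω • g))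
          ≤ (vol (dd P) (P.L - 1) K)⁻¹ ^ (2 : ℝ)⁻¹ * (Real.sqrt (P.mesh 0 ^ P.d))⁻¹ * (β * sNorm (chi Ω • g)) :=
            mul_le_mul_of_nonneg_left (h2 j _ (chi_smul_supported Ω g)) hc.le
        _ ≤ (vol (dd P) (P.L - 1) K)⁻¹ ^ (2 : ℝ)⁻¹ * (Real.sqrt (P.mesh 0 ^ P.d))⁻¹ * (β * sNorm g) :=
            mul_le_mul_of_nonneg_left (mul_le_mul_of_nonneg_left (sNorm_chi_smul_le Ω g) hβ) hc.le
        _ = β * ((vol (dd P) (P.L - 1) K)⁻¹ ^ (2 : ℝ)⁻¹ * (Real.sqrt (P.mesh 0 ^ P.d))⁻¹ * sNorm g) := by ring)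
    (fun j hj g => by
      show nrmT K n₀ 0 (bOpP C K K₀ Ω A msq a j g) ≤ β * nrmT K n₀ 0 g
      rw [bOpP_apply, nrmT_zero, nrmT_zero]
      exact (h0 j hj _).trans (mul_le_mul_of_nonneg_left (norm_chi_smul_le Ω g) hβ))
    hV
    (by rw [nrmT_top hn₀0, nrmT_zero]; exact hfV)
    (by rw [nrmT_zero]; exact norm_nonneg f)
    (fun n i hi ys hw t ht => by
      rw [hS₀, Finset.mem_filter] at hi
      refine cube_subset_of_walk hK hK₀ hR hw hi.2 t ?_
      have : (t : ℕ) + 2 ≤ n₀ + 1 := by omega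
      nlinarith [Nat.zero_le (half P K K₀)])
    (fun j => card_filter_ladj_le hK hK₀ hK₀' j)
    (by rw [Nat.cast_pow, Nat.cast_ofNat]; exact hDβ)
    (fun n i hi ys hw hl => by
      rw [hS₀, Finset.mem_filter] at hi
      rw [hS₁, Finset.mem_filter] at hl
      obtain ⟨y, hy, hyn⟩ := hl.2
      have hd := tdist_le_of_walk_near hK hK₀ hw hi.2 hyn
      have hD := hf y hy
      rw [hNn]
      refine Nat.ceil_le.2 ?_
      rw [div_le_iff₀ (by positivity)]
      have : ((Dist : ℕ) : ℝ) ≤ 4 * rS P K K₀ + 2 * half P K K₀ * n := by exact_mod_cast hD.trans hd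
      linarith)
    (by linarith)
  -- read off the bound
  have hΦ : ‖propagatorK C Ω A msq a K (chi Ω • f) x‖ = ‖(GP C K Ω A msq a • f) x‖ := rfl
  rw [hΦ]
  refine hmain.trans ?_
  rw [nrmT_zero]
  have hS₀card : (S₀.card : ℝ) ≤ 2 ^ P.d := by exact_mod_cast card_filter_near_rS_le hK hK₀ hK₀8 x
  have hexp : Real.exp 2 * Real.exp (-((Nn : ℝ) + 2)) ≤ Real.exp (-(((Dist : ℝ) - 4 * rS P K K₀) / (2 * half P K K₀))) := by
    rw [← Real.exp_add]
    refine Real.exp_le_exp.2 ?_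
    have := Nat.le_ceil (((Dist : ℝ) - 4 * rS P K K₀) / (2 * half P K K₀))
    rw [← hNn] at this
    linarith
  have hVf : 0 ≤ V * ‖f‖ := mul_nonneg (zero_le_one.trans hV) (norm_nonneg f)
  calc 2 * (S₀.card : ℝ) * γ * V * Real.exp 2 * Real.exp (-((Nn : ℝ) + 2)) * ‖f‖
      = (S₀.card : ℝ) * (Real.exp 2 * Real.exp (-((Nn : ℝ) + 2))) * (2 * γ * (V * ‖f‖)) := by ring
    _ ≤ 2 ^ P.d * Real.exp (-(((Dist : ℝ) - 4 * rS P K K₀) / (2 * half P K K₀))) * (2 * γ * (V * ‖f‖)) :=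
        mul_le_mul_of_nonneg_right (mul_le_mul hS₀card hexp (by positivity) (by positivity)) (by positivity)
    _ = 2 * 2 ^ P.d * γ * V * Real.exp (-(((Dist : ℝ) - 4 * rS P K K₀) / (2 * half P K K₀))) * ‖f‖ := by ring

end Chain

end Literature.MathematicalPhysics.QuantumFieldTheory.Balaban1983to89.B1Ineq225RegionChain

end
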